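import Mathlib
import HarnessLib
import Literature.Combinatorics.Additive.StepBeyondKempermanReduction

/-!
# Grynkiewicz 2009, §6 Claim 5: the cases `l = 2` and `l = 3`

[cite: Grynkiewicz2009, §6 Claim 5 (proof of Thm 4.1, p. 25: «There are three cases for l»)] [tag: critical-pair] [tag: inverse-theorem]

Topic `Literature/Combinatorics/Additive`.  Cell `mm-stpp` (D-0046), seat `mm-stpp-lit` (gen 23); the
port of D. J. Grynkiewicz, *A step beyond Kemperman's structure theorem*, Mathematika **55** (2009)
67–114 continued.  §6 Claim 5, print p. 25, after `|H| = 2`, «`|{φ_H(aᵢ)}| = |{φ_H(bᵢ)}| = 2`» and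
`φ_H(γ₁) ≠ φ_H(γ₂)` (files `StepBeyondKempermanTwoHoles*.lean`): «There are three cases for `l`.
Suppose `l = 2`.  Hence w.l.o.g. `φ_H(A_{a₁}) + φ_H(B_{b₁}) = φ_H(γ₁)` and
`φ_H(A_{a₂}) + φ_H(B_{b₂}) = φ_H(γ₂)` are both unique modulo `H` expression elements, whence letting `α`
be the other element from the `H`-coset `a₁ + H`, and letting `β` be the other element from the
`H`-coset `b₁ + H`, it follows that `(A ∪ {α}) + (B ∪ {β}) = (A + B) ∪ {γ₁}`, yielding (17).  So we can
assume `l > 2`.  Suppose `l = 3`.  Hence some `φ_H(aᵢ)`, say `φ_H(a_{j₁})`, is contained in only one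
pair `(φ_H(aᵢ), φ_H(bᵢ))`.  Likewise some `φ_H(bᵢ)`, say `φ_H(b_{j₂})`, is also only contained in one
pair.  Hence, since `l = 3`, it follows that `b_{j₁} ≠ b_{j₂}` and `a_{j₁} ≠ a_{j₂}`.  Thus neither
`φ_H(a_{j₂} + b_{j₂})` nor `φ_H(a_{j₁} + b_{j₁})` can equal `φ_H(a_{j₂} + b_{j₁}) ∈ {φ_H(γ₁), φ_H(γ₂)}`,
whence `φ_H(a_{j₁} + b_{j₁}) = φ_H(a_{j₂} + b_{j₂})`, and w.l.o.g. assume `φ_H(a_{j₁} + b_{j₁}) = φ_H(γ₁)`.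
Hence, letting `α ∈ (γ₁ − B) ∩ (A_{a_{j₁}} + H)` and letting `β ∈ (γ₁ − A) ∩ (B_{b_{j₂}} + H)`, it
follows that `(A ∪ {α}) + (B ∪ {β}) = (A + B) ∪ {γ₁}`, whence (17) holds.  So we can assume `l = 4`.»

FRAME (the tree's rendering of the situation, all hypotheses explicit): `(A + B) ∪ {γ₁, γ₂} = A + B + H`
(`H` carried as the finset `Hf`), `γ₁, γ₂ ∉ A + B`, `γ₁ ≢ γ₂ (mod H)`, `|A + B| = |A| + |B|`; two
relevant pairs `(x, y), (x′, y′) ∈ A × B` (sum `≡ γ₁` or `γ₂`) with `x ≢ x′`, `y ≢ y′`; every relevant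
`a ∈ A` is `≡ x` or `≡ x′`, every relevant `b ∈ B` is `≡ y` or `≡ y′`; both `γ₁` and `γ₂` are hit by a
relevant pair (Claim 5's first paragraph).  Then `l` — the number of relevant pairs among the four coset
pairs `{x, x′} × {y, y′}` — is `2`, `3` or `4`, and «`l ≤ 3`» reads «`(x, y′)` or `(x′, y)` is not
relevant».  In the case `l = 2` we take `α = γ₁ − b₁`, `β = γ₁ − a₁` (which ARE «the other elements» of
the cosets `a₁ + H`, `b₁ + H` when `|H| = 2`; the identity `(A ∪ {α}) + (B ∪ {β}) = (A + B) ∪ {γ₁}` is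
all that is used, and it needs neither `|H| = 2` nor the one-hole structure of the cosets).

MAIN RESULTS (0 definitions, 0 named facts; everything PROVED).
* `Grynkiewicz2009.seventeen_of_extension_avoiding` — the common final step: `α ∈ (A + H) ∖ A`,
  `β ∈ (B + H) ∖ B` with `γ ∈ (A ∪ {α}) + (B ∪ {β}) ∌ γ′` give `(A ∪ {α}) + (B ∪ {β}) = (A + B) ∪ {γ}`
  and (17).
* `Grynkiewicz2009.seventeen_of_cross_not_relevant` — the frame with `(x′, y)` not relevant ⟹ (17)
  (both printed cases `l = 2`, `l = 3`).
* `Grynkiewicz2009.seventeen_of_le_three_pairs` — **Claim 5 for `l ≤ 3`**: the frame with some cross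
  pair not relevant ⟹ (17).

## References
* D. J. Grynkiewicz, *A step beyond Kemperman's structure theorem*, Mathematika 55 (2009) 67–114,
  doi:10.1112/S0025579300000966, §6 Claim 5 (p. 25) [cite: Grynkiewicz2009, Thm 4.1 (proof, Claim 5)]
  — held `paper:doi-10-1112-s0025579300000966`, p0025 read 2026-08-29.
-/

namespace Literature.Combinatorics.Additive

open Finset
open scoped Pointwise

universe u

variable {G : Type u} [AddCommGroup G] [DecidableEq G]

namespace Grynkiewicz2009

omit [DecidableEq G] in
/-- Membership transfer along an identity. [folklore] -/
private theorem memH {H : AddSubgroup G} {s t : G} (hs : s ∈ H) (e : t = s) : t ∈ H := by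
  rw [e]; exact hs

/-- **The common final step of the cases `l = 2, 3`.**  With `(A + B) ∪ {γ, γ′} = A + B + H`,
`γ, γ′ ∉ A + B`, `|A + B| = |A| + |B|`: elements `α ∈ (A + H) ∖ A`, `β ∈ (B + H) ∖ B` such that
`γ ∈ (A ∪ {α}) + (B ∪ {β})` while `γ′ ∉ (A ∪ {α}) + (B ∪ {β})` (i.e. `α + β ≠ γ′`, `α + B ∌ γ′`,
`A + β ∌ γ′`) give `(A ∪ {α}) + (B ∪ {β}) = (A + B) ∪ {γ}`, «yielding (17)».
[cite: Grynkiewicz2009, §6 Claim 5 (p. 25)] -/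
theorem seventeen_of_extension_avoiding {A B Hf : Finset G} {H : AddSubgroup G} {γ γ' α β : G}
    (hHf : ∀ g, g ∈ Hf ↔ g ∈ H) (hC' : insert γ (insert γ' (A + B)) = A + B + Hf)
    (hγ : γ ∉ A + B) (hγ' : γ' ∉ A + B) (hAB : #(A + B) = #A + #B)
    (hα : α ∈ A + Hf) (hβ : β ∈ B + Hf) (hαA : α ∉ A) (hβB : β ∉ B)
    (hγS : γ ∈ insert α A + insert β B) (hαβ : α + β ≠ γ') (hαv : ∀ v ∈ B, α + v ≠ γ')
    (huβ : ∀ u ∈ A, u + β ≠ γ') :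
    ∃ α β : G, #(insert α A + insert β B) + 1 = #(insert α A) + #(insert β B) := by
  classical
  refine ⟨α, β, ?_⟩
  have h0 : (0 : G) ∈ Hf := (hHf 0).2 H.zero_mem
  have hHfper : IsPeriodicWith H Hf := fun h hh => vadd_finset_eq_of_forall_mem_iff hHf hh
  have hS : insert α A + insert β B = insert γ (A + B) := by
    refine Subset.antisymm (fun z hz => ?_)
      (insert_subset hγS (add_subset_add (subset_insert _ _) (subset_insert _ _)))
    obtain ⟨u, hu, v, hv, rfl⟩ := mem_add.1 hz
    have hu' : u ∈ A + Hf := by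
      rw [mem_insert] at hu
      rcases hu with rfl | hu
      · exact hα
      · exact subset_add_left A h0 hu
    have hv' : v ∈ B + Hf := by
      rw [mem_insert] at hv
      rcases hv with rfl | hv
      · exact hβ
      · exact subset_add_left B h0 hv
    have hmem : u + v ∈ insert γ (insert γ' (A + B)) := by
      rw [hC', show A + B + Hf = (A + Hf) + (B + Hf) by
        rw [add_add_add_comm, (isPeriodicWith_iff_add_eq hHf).1 hHfper]]
      exact add_mem_add hu' hv'
    rw [mem_insert, mem_insert] at hmem
    rw [mem_insert]
    rcases hmem with h | h | h
    · exact Or.inl h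
    · exfalso
      rw [mem_insert] at hu hv
      rcases hu with hu | hu <;> rcases hv with hv | hv
      · rw [hu, hv] at h; exact hαβ h
      · rw [hu] at h; exact hαv v hv h
      · rw [hv] at h; exact huβ u hu h
      · exact hγ' (h ▸ add_mem_add hu hv)
    · exact Or.inr h
  rw [hS, card_insert_of_notMem hγ, card_insert_of_notMem hαA, card_insert_of_notMem hβB, hAB]
  omega

/-- **The cases `l = 2` and `l = 3`, with `(x′, y)` the non-relevant cross pair.**  FRAME: as in the
module docstring, written for a pair `(γ, γ′)` of the two new elements with `x + y ≡ γ (mod H)`.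
If `(x′, y)` is not relevant then (17) holds: when `(x, y′)` is not relevant either (`l = 2`) take
`α = γ − y ∈ x + H`, `β = γ − x ∈ y + H`; when `(x, y′)` is relevant (`l = 3`; then `x + y′ ≡ γ′` and
`x′ + y′ ≡ γ`) take `α = γ − y′ ∈ x′ + H`, `β = γ − x ∈ y + H`; in both cases
`(A ∪ {α}) + (B ∪ {β}) = (A + B) ∪ {γ}` by `seventeen_of_extension_avoiding`, the exclusion of `γ′`
coming from «every relevant `a` is `≡ x, x′`, every relevant `b` is `≡ y, y′`», `γ ≢ γ′` and the
non-relevance of `(x′, y)`. [cite: Grynkiewicz2009, §6 Claim 5 (p. 25, cases l = 2, 3)] -/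
theorem seventeen_of_cross_not_relevant {A B Hf : Finset G} {H : AddSubgroup G}
    {γ γ' x y x' y' : G} (hHf : ∀ g, g ∈ Hf ↔ g ∈ H)
    (hC' : insert γ (insert γ' (A + B)) = A + B + Hf) (hγ : γ ∉ A + B) (hγ' : γ' ∉ A + B)
    (hγγ' : γ - γ' ∉ H) (hAB : #(A + B) = #A + #B)
    (hx : x ∈ A) (hy : y ∈ B) (hx' : x' ∈ A) (hy' : y' ∈ B) (hxx' : x - x' ∉ H)
    (hyy' : y - y' ∉ H) (hxy : x + y - γ ∈ H) (hx'y' : x' + y' - γ ∈ H ∨ x' + y' - γ' ∈ H)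
    (hrelA : ∀ u ∈ A, ∀ v ∈ B, (u + v - γ ∈ H ∨ u + v - γ' ∈ H) → u - x ∈ H ∨ u - x' ∈ H)
    (hrelB : ∀ u ∈ A, ∀ v ∈ B, (u + v - γ ∈ H ∨ u + v - γ' ∈ H) → v - y ∈ H ∨ v - y' ∈ H)
    (hcov' : ∃ u ∈ A, ∃ v ∈ B, u + v - γ' ∈ H) (hn : x' + y - γ ∉ H ∧ x' + y - γ' ∉ H) :
    ∃ α β : G, #(insert α A + insert β B) + 1 = #(insert α A) + #(insert β B) := by
  classical
  have hβ : γ - x ∈ B + Hf :=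
    mem_add.2 ⟨y, hy, γ - x - y, (hHf _).2 (memH (H.neg_mem hxy) (by abel)), by abel⟩
  have hβB : γ - x ∉ B := fun h => hγ (by
    have := add_mem_add hx h
    rwa [add_sub_cancel] at this)
  -- `A + β ∌ γ'` (common to both cases)
  have huβ : ∀ u ∈ A, u + (γ - x) ≠ γ' := by
    intro u hu e
    have huy : u + y - γ' ∈ H := memH hxy (by rw [← e]; abel)
    rcases hrelA u hu y hy (Or.inr huy) with h | h
    · exact hγγ' (memH (H.sub_mem (H.sub_mem huy h) hxy) (by abel))
    · exact hn.2 (memH (H.sub_mem huy h) (by abel))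
  by_cases hc : x + y' - γ ∈ H ∨ x + y' - γ' ∈ H
  · -- `l = 3`: `x + y' ≡ γ'`, `x' + y' ≡ γ`
    have h3 : x + y' - γ' ∈ H :=
      hc.resolve_left fun h => hyy' (memH (H.sub_mem hxy h) (by abel))
    have h4 : x' + y' - γ ∈ H :=
      hx'y'.resolve_right fun h => hxx' (memH (H.sub_mem h3 h) (by abel))
    refine seventeen_of_extension_avoiding hHf hC' hγ hγ' hAB (α := γ - y') (β := γ - x)
      (mem_add.2 ⟨x', hx', γ - x' - y', (hHf _).2 (memH (H.neg_mem h4) (by abel)), by abel⟩) hβ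
      (fun h => hγ (by
        have := add_mem_add h hy'
        rwa [sub_add_cancel] at this)) hβB
      (by
        have := add_mem_add (mem_insert_self (γ - y') A) (mem_insert_of_mem (b := γ - x) hy')
        rwa [sub_add_cancel] at this)
      (fun e => hn.2 (memH (H.add_mem h4 hxy) (by rw [← e]; abel))) (fun v hv e => ?_) huβ
    have hx'v : x' + v - γ' ∈ H := memH h4 (by rw [← e]; abel)
    rcases hrelB x' hx' v hv (Or.inr hx'v) with h | h
    · exact hn.2 (memH (H.sub_mem hx'v h) (by abel))
    · exact hγγ' (memH (H.sub_mem (H.sub_mem hx'v h) h4) (by abel))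
  · -- `l = 2`: `x' + y' ≡ γ'`
    push Not at hc
    have h4 : x' + y' - γ' ∈ H := by
      obtain ⟨u, hu, v, hv, huv⟩ := hcov'
      rcases hrelA u hu v hv (Or.inr huv) with ha | ha <;>
        rcases hrelB u hu v hv (Or.inr huv) with hb | hb
      · exact absurd (memH (H.sub_mem (H.sub_mem (H.sub_mem huv ha) hb) hxy) (by abel)) hγγ'
      · exact absurd (memH (H.sub_mem (H.sub_mem huv ha) hb) (by abel)) hc.2
      · exact absurd (memH (H.sub_mem (H.sub_mem huv ha) hb) (by abel)) hn.2
      · exact memH (H.sub_mem (H.sub_mem huv ha) hb) (by abel)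
    refine seventeen_of_extension_avoiding hHf hC' hγ hγ' hAB (α := γ - y) (β := γ - x)
      (mem_add.2 ⟨x, hx, γ - x - y, (hHf _).2 (memH (H.neg_mem hxy) (by abel)), by abel⟩) hβ
      (fun h => hγ (by
        have := add_mem_add h hy
        rwa [sub_add_cancel] at this)) hβB
      (by
        have := add_mem_add (mem_insert_self (γ - y) A) (mem_insert_of_mem (b := γ - x) hy)
        rwa [sub_add_cancel] at this)
      (fun e => hγγ' (memH hxy (by rw [← e]; abel))) (fun v hv e => ?_) huβ
    have hxv : x + v - γ' ∈ H := memH hxy (by rw [← e]; abel)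
    rcases hrelB x hx v hv (Or.inr hxv) with h | h
    · exact hγγ' (memH (H.sub_mem (H.sub_mem hxv h) hxy) (by abel))
    · exact hc.2 (memH (H.sub_mem hxv h) (by abel))

/-- **Claim 5 for `l ≤ 3`.**  In the FRAME of the module docstring (stated for `(γ₁, γ₂)`): if one of
the cross pairs `(x, y′)`, `(x′, y)` is not relevant, then (17) holds.  Reduction to
`seventeen_of_cross_not_relevant` by the symmetries `(x, y) ↔ (x′, y′)` and `γ₁ ↔ γ₂`.
[cite: Grynkiewicz2009, §6 Claim 5 (p. 25, «There are three cases for l … So we can assume l = 4»)] -/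
theorem seventeen_of_le_three_pairs {A B Hf : Finset G} {H : AddSubgroup G}
    {γ₁ γ₂ x y x' y' : G} (hHf : ∀ g, g ∈ Hf ↔ g ∈ H)
    (hC' : insert γ₁ (insert γ₂ (A + B)) = A + B + Hf) (hγ₁ : γ₁ ∉ A + B) (hγ₂ : γ₂ ∉ A + B)
    (hγ₁₂ : γ₁ - γ₂ ∉ H) (hAB : #(A + B) = #A + #B)
    (hx : x ∈ A) (hy : y ∈ B) (hx' : x' ∈ A) (hy' : y' ∈ B) (hxx' : x - x' ∉ H)
    (hyy' : y - y' ∉ H) (hxy : x + y - γ₁ ∈ H ∨ x + y - γ₂ ∈ H)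
    (hx'y' : x' + y' - γ₁ ∈ H ∨ x' + y' - γ₂ ∈ H)
    (hrelA : ∀ u ∈ A, ∀ v ∈ B, (u + v - γ₁ ∈ H ∨ u + v - γ₂ ∈ H) → u - x ∈ H ∨ u - x' ∈ H)
    (hrelB : ∀ u ∈ A, ∀ v ∈ B, (u + v - γ₁ ∈ H ∨ u + v - γ₂ ∈ H) → v - y ∈ H ∨ v - y' ∈ H)
    (hcov₁ : ∃ u ∈ A, ∃ v ∈ B, u + v - γ₁ ∈ H) (hcov₂ : ∃ u ∈ A, ∃ v ∈ B, u + v - γ₂ ∈ H)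
    (hl : (x + y' - γ₁ ∉ H ∧ x + y' - γ₂ ∉ H) ∨ (x' + y - γ₁ ∉ H ∧ x' + y - γ₂ ∉ H)) :
    ∃ α β : G, #(insert α A + insert β B) + 1 = #(insert α A) + #(insert β B) := by
  have hC'' : insert γ₂ (insert γ₁ (A + B)) = A + B + Hf := by rw [Finset.insert_comm]; exact hC'
  have hγ₂₁ : γ₂ - γ₁ ∉ H := fun h => hγ₁₂ (memH (H.neg_mem h) (by abel))
  have hx'x : x' - x ∉ H := fun h => hxx' (memH (H.neg_mem h) (by abel))
  have hy'y : y' - y ∉ H := fun h => hyy' (memH (H.neg_mem h) (by abel))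
  -- the frame with `γ₁ ↔ γ₂`
  have hrelA₂ : ∀ u ∈ A, ∀ v ∈ B, (u + v - γ₂ ∈ H ∨ u + v - γ₁ ∈ H) → u - x ∈ H ∨ u - x' ∈ H :=
    fun u hu v hv h => hrelA u hu v hv h.symm
  have hrelB₂ : ∀ u ∈ A, ∀ v ∈ B, (u + v - γ₂ ∈ H ∨ u + v - γ₁ ∈ H) → v - y ∈ H ∨ v - y' ∈ H :=
    fun u hu v hv h => hrelB u hu v hv h.symm
  rcases hl with hn | hn
  · -- `(x, y')` not relevant: main diagonal `(x', y'), (x, y)`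
    have hrelA' : ∀ u ∈ A, ∀ v ∈ B, (u + v - γ₁ ∈ H ∨ u + v - γ₂ ∈ H) →
        u - x' ∈ H ∨ u - x ∈ H := fun u hu v hv h => (hrelA u hu v hv h).symm
    have hrelB' : ∀ u ∈ A, ∀ v ∈ B, (u + v - γ₁ ∈ H ∨ u + v - γ₂ ∈ H) →
        v - y' ∈ H ∨ v - y ∈ H := fun u hu v hv h => (hrelB u hu v hv h).symm
    rcases hx'y' with h | h
    · exact seventeen_of_cross_not_relevant hHf hC' hγ₁ hγ₂ hγ₁₂ hAB hx' hy' hx hy hx'x hy'y h hxy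
        hrelA' hrelB' hcov₂ hn
    · exact seventeen_of_cross_not_relevant hHf hC'' hγ₂ hγ₁ hγ₂₁ hAB hx' hy' hx hy hx'x hy'y h
        hxy.symm (fun u hu v hv h' => (hrelA₂ u hu v hv h').symm)
        (fun u hu v hv h' => (hrelB₂ u hu v hv h').symm) hcov₁ ⟨hn.2, hn.1⟩
  · -- `(x', y)` not relevant: main diagonal `(x, y), (x', y')`
    rcases hxy with h | h
    · exact seventeen_of_cross_not_relevant hHf hC' hγ₁ hγ₂ hγ₁₂ hAB hx hy hx' hy' hxx' hyy' h hx'y'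
        hrelA hrelB hcov₂ hn
    · exact seventeen_of_cross_not_relevant hHf hC'' hγ₂ hγ₁ hγ₂₁ hAB hx hy hx' hy' hxx' hyy' h
        hx'y'.symm hrelA₂ hrelB₂ hcov₁ ⟨hn.2, hn.1⟩

end Grynkiewicz2009

end Literature.Combinatorics.Additive
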